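import Summits.Schanuel.Schanuel.Theorems.RootDecomp1KRadical01

/-!
# RootDecomp1KRadical («RADICAL CELLS», lens 6 gen 11) — continuation (RootDecomp1KRadical02): §23b the eliminant S(Y) = Res_W(W^q − Y^pn, F̂) (resY, aeval_resY, degree bounds) + §23c its height via Parseval (abs_coeff_resY_le) + §23d real-number endgame lemmas (endgame_type)

Part of the six-file split (400-line rule) of lens 6's gen-11 node «RADICAL CELLS» = HOME/decomp-schanuel-lens-6/g11/addendum/RadicalCells.lean (sha256 16cddffc…, 2182 l;
1K ROUND 8 THEOREM ROUND, PATH T; critic VERDICT 2026-08-30T18:23:36Z ACCEPTED; census C-7bis; `--supports stmt-Schanuel-33363`). Port hygiene: the node's COPY blocks of §19/§21/§22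
declarations are NOT re-declared — they are the landed ones of Theorems/RootDecomp1KDark*/Torsion*/Kummer* (opened by name); twins of private/foreign tree lemmas are private here.
All parts share the namespace `Summit.Schanuel.Schanuel.Theorems.RootDecomp1KRadical`; the node docstring is in part 01. Sorry-free; standard axioms. Nothing here proves Schanuel; rung 0.
-/

noncomputable section

open Complex IntermediateField Polynomial

namespace Summit.Schanuel.Schanuel.Theorems.RootDecomp1KRadical

open Summit.Schanuel.Schanuel.Theorems.RootDecomp1KHyper (len len_nonneg one_le_len abs_coeff_le_len)
open Summit.Schanuel.Schanuel.Theorems.RootDecomp1KHyper.HyperCell (norm_aeval_le_len_mul_pow conjFactor sliceAt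
  relHat resPoly eval_conjFactor eval_sliceAt natDegree_conjFactor_le coeff_conjFactor natDegree_sliceAt_le
  natDegree_relHat_le evC evC_apply evC_comp_C map_relHat_evC relLen relLen_nonneg eval_map_int
  isAlgebraic_of_aeval_int norm_multiset_map_prod_le multiset_map_prod_le torCo torG aeval_torG natDegree_torG_le
  coeff_torG torCo_cast_eq eval_conjFactor_torG torD coeff_torD torD_ne_zero coeff_torG_eq_torD denBound
  den_lt_denBound norm_mvaeval_le cP cP_nonneg one_le_cP abs_torCo_le abs_coeff_torG_le len_torG_le relLen_torG_le
  pow_le_exp_mul eta_lt_delta upper_exp algebraicIndependent_of_forall_int HyperLiouville.rat_mul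
  dvd_of_irreducible_of_common_root pair_bounds HyperLiouville.ne_ratCast HyperLiouville.ne_zero HyperLiouville.neg)

variable {K : ℕ}

open Summit.Schanuel.Schanuel.Theorems.RootDecomp1KHyper.HyperCell (HyperLiouville)
open Summit.Schanuel.Schanuel.Theorems.RootDecomp1KHyper (WMeasure SB SFset sb_of_algebraicIndependent
  mem_adjoin_SFset_I')

/-! ### 23b. The eliminant `S(Y) = Res_W(W^q − Y^pn, F̂(Y, W)) ∈ ℤ[Y]` -/

/-- `W^q − Y^pn ∈ (ℤ[Y])[W]` -/
def kumHat (q pn : ℕ) : Polynomial (Polynomial ℤ) := X ^ q - C (X ^ pn)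

/-- the eliminant `Res_W(W^q − Y^pn, Σ_k C(Y^k) G_k(W))` with formal degrees `(q, N)` -/
def resY (q pn : ℕ) (G : Fin (K + 1) → ℤ[X]) (N : ℕ) : ℤ[X] :=
  Polynomial.resultant (kumHat q pn) (relHat G) q N

/-- `(kumHat q pn).map (evC u) = X ^ q - C (u ^ pn)`. -/
theorem map_kumHat_evC (q pn : ℕ) (u : ℂ) : (kumHat q pn).map (evC u) = X ^ q - C (u ^ pn) := by
  rw [kumHat, Polynomial.map_sub, Polynomial.map_pow, map_X, map_C, evC_apply, map_pow, aeval_X]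

/-- **Specialisation of the eliminant at ANY `u ∈ ℂ`**: `S(u) = ∏_{b : b^q = u^pn} F(u, b)`. -/
theorem aeval_resY {q : ℕ} (hq : 0 < q) (pn : ℕ) (G : Fin (K + 1) → ℤ[X]) {N : ℕ}
    (hN : ∀ k, (G k).natDegree ≤ N) (u : ℂ) :
    aeval u (resY q pn G N) =
      (((X ^ q - C (u ^ pn) : ℂ[X]).roots).map fun b => (conjFactor G b).eval u).prod := by
  rw [← evC_apply, resY, ← Polynomial.resultant_map_map, map_kumHat_evC, map_relHat_evC]
  have h := Polynomial.resultant_eq_prod_eval (X ^ q - C (u ^ pn) : ℂ[X]) (sliceAt G u) N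
    (natDegree_sliceAt_le G u hN) (IsAlgClosed.splits _)
  rw [natDegree_X_pow_sub_C, (monic_X_pow_sub_C (u ^ pn) hq.ne').leadingCoeff, one_pow,
    one_mul] at h
  rw [h]
  refine congrArg Multiset.prod (Multiset.map_congr rfl fun b _ => ?_)
  rw [eval_sliceAt, eval_conjFactor]

/-- §23b. Membership in the roots of the Kummer polynomial `X ^ q - C (u ^ pn)`: `b` is a root iff `b ^ q = u ^ pn` (for `0 < q`). -/
theorem mem_roots_kummer {q : ℕ} (hq : 0 < q) {c b : ℂ} :
    b ∈ (X ^ q - C c : ℂ[X]).roots ↔ b ^ q = c := by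
  rw [mem_roots (monic_X_pow_sub_C c hq.ne').ne_zero, IsRoot.def, eval_sub, eval_pow, eval_X, eval_C,
    sub_eq_zero]

/-- §23b. The Kummer polynomial `X ^ q - C (u ^ pn)` has at most `q` roots (with multiplicity). -/
theorem card_roots_kummer_le (q : ℕ) (c : ℂ) :
    Multiset.card (X ^ q - C c : ℂ[X]).roots ≤ q :=
  (card_roots' _).trans (by rw [natDegree_X_pow_sub_C])

/-- Sylvester entries: degree bound column by column. -/
theorem natDegree_sylvester_le {R : Type*} [CommRing R] (f g : (R[X])[X]) (m n a b : ℕ)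
    (hf : ∀ i, (f.coeff i).natDegree ≤ a) (hg : ∀ i, (g.coeff i).natDegree ≤ b)
    (i j : Fin (m + n)) :
    (Polynomial.sylvester f g m n i j).natDegree ≤ Fin.addCases (fun _ => b) (fun _ => a) j := by
  induction j using Fin.addCases with
  | left j =>
    simp only [Polynomial.sylvester, Matrix.of_apply, Fin.addCases_left]
    split_ifs
    · exact hg _
    · simp
  | right j =>
    simp only [Polynomial.sylvester, Matrix.of_apply, Fin.addCases_right]
    split_ifs
    · exact hf _
    · simp

/-- **Degree of a resultant over `R[Y]`** (Leibniz expansion of the Sylvester determinant):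
`deg_Y Res_W(f, g; m, n) ≤ m · b + n · a` if the `W`-coefficients of `f`, `g` have `Y`-degrees
`≤ a`, `≤ b`. -/
theorem natDegree_resultant_le {R : Type*} [CommRing R] (f g : (R[X])[X]) (m n a b : ℕ)
    (hf : ∀ i, (f.coeff i).natDegree ≤ a) (hg : ∀ i, (g.coeff i).natDegree ≤ b) :
    (Polynomial.resultant f g m n).natDegree ≤ m * b + n * a := by
  rw [Polynomial.resultant, Matrix.det_apply]
  refine natDegree_sum_le_of_forall_le _ _ fun σ _ => ?_
  rw [Units.smul_def]
  refine (natDegree_smul_le _ _).trans ?_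
  refine (natDegree_prod_le _ _).trans ?_
  calc ∑ i, (Polynomial.sylvester f g m n (σ i) i).natDegree
      ≤ ∑ i : Fin (m + n), (Fin.addCases (fun _ => b) (fun _ => a) i : ℕ) :=
        Finset.sum_le_sum fun i _ => natDegree_sylvester_le f g m n a b hf hg (σ i) i
    _ = m * b + n * a := by
        rw [Fin.sum_univ_add]
        simp only [Fin.addCases_left, Fin.addCases_right, Finset.sum_const, Finset.card_univ,
          Fintype.card_fin, smul_eq_mul]

/-- `((kumHat q pn).coeff i).natDegree ≤ pn`. -/
theorem natDegree_coeff_kumHat_le (q pn i : ℕ) : ((kumHat q pn).coeff i).natDegree ≤ pn := by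
  rw [kumHat, coeff_sub, coeff_X_pow, coeff_C]
  refine (natDegree_sub_le _ _).trans (max_le ?_ ?_)
  · split_ifs <;> simp
  · split_ifs
    · rw [natDegree_X_pow]
    · simp

/-- §23b. Degree bound for the coefficients of `relHat G` in the eliminated variable. -/
theorem natDegree_coeff_relHat_le (G : Fin (K + 1) → ℤ[X]) (i : ℕ) :
    ((relHat G).coeff i).natDegree ≤ K := by
  rw [relHat, finsetSum_coeff]
  refine natDegree_sum_le_of_forall_le _ _ fun k _ => ?_
  rw [coeff_C_mul, coeff_map]
  refine natDegree_mul_le.trans ?_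
  rw [natDegree_X_pow, natDegree_C, add_zero]
  exact Nat.lt_succ_iff.mp k.2

/-- `deg S ≤ q K + N pn`. -/
theorem natDegree_resY_le (q pn : ℕ) (G : Fin (K + 1) → ℤ[X]) (N : ℕ) :
    (resY q pn G N).natDegree ≤ q * K + N * pn :=
  natDegree_resultant_le _ _ q N pn K (natDegree_coeff_kumHat_le q pn) (natDegree_coeff_relHat_le G)

/-! ### 23c. The height of the eliminant, via Parseval on the unit circle -/

/-- coefficients are bounded by the sup of the polynomial on the unit circle (Parseval) -/
theorem norm_coeff_le_of_circle_bound (S : ℂ[X]) {M : ℝ} (hM : 0 ≤ M)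
    (h : ∀ u : ℂ, ‖u‖ = 1 → ‖S.eval u‖ ≤ M) (k : ℕ) : ‖S.coeff k‖ ≤ M := by
  have hP := S.sum_sq_norm_coeff_eq_circleAverage
  have hint : CircleIntegrable (fun θ : ℂ => ‖S.eval θ‖ ^ 2) 0 1 := by
    apply ContinuousOn.circleIntegrable zero_le_one
    exact ((S.continuous).norm.pow 2).continuousOn
  have havg : Real.circleAverage (fun θ : ℂ => ‖S.eval θ‖ ^ 2) 0 1 ≤ M ^ 2 := by
    refine Real.circleAverage_mono_on_of_le_circle hint fun u hu => ?_
    have hu1 : ‖u‖ = 1 := by simpa using hu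
    exact pow_le_pow_left₀ (norm_nonneg _) (h u hu1) 2
  have hk : ‖S.coeff k‖ ^ 2 ≤ M ^ 2 := by
    by_cases hks : k ∈ S.support
    · calc ‖S.coeff k‖ ^ 2 ≤ ∑ i ∈ S.support, ‖S.coeff i‖ ^ 2 :=
            Finset.single_le_sum (f := fun i => ‖S.coeff i‖ ^ 2) (fun i _ => sq_nonneg _) hks
        _ ≤ M ^ 2 := hP ▸ havg
    · rw [notMem_support_iff.mp hks, norm_zero, zero_pow two_ne_zero]; positivity
  exact (pow_le_pow_iff_left₀ (norm_nonneg _) hM two_ne_zero).mp hk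

/-- on the unit circle `|u| = 1` every factor `F(u, b)`, `b^q = u^pn`, is at most `L = Σ_k len G_k` -/
theorem norm_aeval_resY_le_of_norm_eq_one {q : ℕ} (hq : 0 < q) (pn : ℕ) (G : Fin (K + 1) → ℤ[X])
    {N : ℕ} (hN : ∀ k, (G k).natDegree ≤ N) {u : ℂ} (hu : ‖u‖ = 1) :
    ‖aeval u (resY q pn G N)‖ ≤ (max 1 (relLen G)) ^ q := by
  rw [aeval_resY hq pn G hN u]
  have hroots : ∀ b ∈ (X ^ q - C (u ^ pn) : ℂ[X]).roots, ‖b‖ = 1 := by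
    intro b hb
    have hbq : b ^ q = u ^ pn := (mem_roots_kummer hq).mp hb
    have h1 : ‖b‖ ^ q = 1 := by rw [← norm_pow, hbq, norm_pow, hu, one_pow]
    exact (pow_eq_one_iff_of_nonneg (norm_nonneg _) hq.ne').mp h1
  have hfac : ∀ b ∈ (X ^ q - C (u ^ pn) : ℂ[X]).roots,
      ‖(conjFactor G b).eval u‖ ≤ max 1 (relLen G) := by
    intro b hb
    rw [eval_conjFactor]
    refine (norm_sum_le _ _).trans (le_trans ?_ (le_max_right _ _))
    rw [relLen]
    refine Finset.sum_le_sum fun k _ => ?_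
    rw [norm_mul, norm_pow, hu, one_pow, mul_one]
    have := norm_aeval_le_len_mul_pow (G k) (hN k) b
    rw [hroots b hb, max_self, one_pow, mul_one] at this
    exact this
  refine (norm_multiset_map_prod_le _ (by positivity) _ hfac).trans ?_
  exact pow_le_pow_right₀ (le_max_left _ _) (card_roots_kummer_le q _)

/-- **Height of the eliminant**: every coefficient of `S` is at most `max(1, L)^q`. -/
theorem abs_coeff_resY_le {q : ℕ} (hq : 0 < q) (pn : ℕ) (G : Fin (K + 1) → ℤ[X]) {N : ℕ}
    (hN : ∀ k, (G k).natDegree ≤ N) (k : ℕ) :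
    ((|(resY q pn G N).coeff k| : ℤ) : ℝ) ≤ (max 1 (relLen G)) ^ q := by
  have h := norm_coeff_le_of_circle_bound ((resY q pn G N).map (Int.castRingHom ℂ))
    (M := (max 1 (relLen G)) ^ q) (by positivity)
    (fun u hu => by rw [eval_map_int]; exact norm_aeval_resY_le_of_norm_eq_one hq pn G hN hu) k
  rw [coeff_map, eq_intCast, Complex.norm_intCast] at h
  rwa [Int.cast_abs]

/-! ### 21j. Elementary exponential bounds -/

/-- `Real.log x ≤ x`. -/
private theorem log_le_self_of_pos {x : ℝ} (hx : 0 < x) : Real.log x ≤ x := by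
  linarith [Real.log_le_sub_one_of_pos hx]

/-- `x ≤ Real.exp x`. -/
private theorem self_le_exp (x : ℝ) : x ≤ Real.exp x := by linarith [Real.add_one_le_exp x]

open Summit.Schanuel.Schanuel.Theorems.RootDecomp1KHyper.HyperCell (HyperLiouville)

open Summit.Schanuel.Schanuel.Theorems.RootDecomp1KHyper (WMeasure SB SFset sb_of_algebraicIndependent
  mem_adjoin_SFset_I')

/-! ### 23d. Real-number lemmas of the Lindemann endgame (kept out of the big context) -/

/-- `log log 16 > 1` (as in the tree's `RootDecomp1KHyper02`). -/
private theorem one_lt_log_log_sixteen : (1 : ℝ) < Real.log (Real.log 16) := by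
  have h2 : (0.6931471803 : ℝ) < Real.log 2 := Real.log_two_gt_d9
  have h16 : Real.log 16 = 4 * Real.log 2 := by
    rw [show (16 : ℝ) = 2 ^ 4 by norm_num, Real.log_pow]; norm_num
  have he : Real.exp 1 < Real.log 16 := by
    rw [h16]; have := Real.exp_one_lt_d9; linarith
  rwa [Real.lt_log_iff_exp_lt (by rw [h16]; linarith)]

/-- `Real.log 32 ≤ 5`. -/
private theorem log_thirtytwo_le_five : Real.log 32 ≤ 5 := by
  have h2 : Real.log 2 < 0.6931471808 := Real.log_two_lt_d9
  rw [show (32 : ℝ) = 2 ^ 5 by norm_num, Real.log_pow]; push_cast; linarith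

/-- the height of the eliminant: `log H ≤ (5 + A + D) Q²` for `H ≤ 17 + (A Q^D)^q`. -/
theorem log_height_le {A Q T : ℝ} {D q Hn : ℕ} (hA1 : 1 ≤ A) (hQ1 : 1 ≤ Q) (hqQ : (q : ℝ) = Q)
    (hT : T = (A * Q ^ D) ^ q) (hHn : (Hn : ℝ) ≤ 16 + (T + 1)) (hHn16 : 16 ≤ Hn) :
    Real.log Hn ≤ (5 + A + D) * Q ^ 2 := by
  have hA0 : 0 < A := by linarith
  have hQ0 : 0 < Q := by linarith
  have hAQ1 : 1 ≤ A * Q ^ D := one_le_mul_of_one_le_of_one_le hA1 (one_le_pow₀ hQ1)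
  have hT1 : 1 ≤ T := hT ▸ one_le_pow₀ hAQ1
  have hHnpos : (0 : ℝ) < Hn := by exact_mod_cast (show 0 < Hn by omega)
  have h1 : (Hn : ℝ) ≤ 32 * T := by linarith
  have h2 : Real.log Hn ≤ Real.log 32 + Real.log T := by
    rw [← Real.log_mul (by norm_num) (by linarith)]
    exact Real.log_le_log hHnpos h1
  have h3 : Real.log T = Q * (Real.log A + D * Real.log Q) := by
    rw [hT, Real.log_pow, hqQ, Real.log_mul hA0.ne' (pow_pos hQ0 D).ne', Real.log_pow]
  have h4 : Real.log A ≤ A := log_le_self_of_pos hA0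
  have h5 : Real.log Q ≤ Q := log_le_self_of_pos hQ0
  have hD0 : (0 : ℝ) ≤ D := Nat.cast_nonneg D
  have h6 : Real.log A + D * Real.log Q ≤ A + D * Q := by
    have := mul_le_mul_of_nonneg_left h5 hD0; linarith
  have h7 : Q * (Real.log A + D * Real.log Q) ≤ Q * (A + D * Q) := mul_le_mul_of_nonneg_left h6 hQ0.le
  have hQQ : Q ≤ Q ^ 2 := by nlinarith
  have h1Q : (1 : ℝ) ≤ Q ^ 2 := by nlinarith
  have h8 : Q * (A + D * Q) ≤ A * Q ^ 2 + D * Q ^ 2 := by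
    have := mul_le_mul_of_nonneg_left hQQ hA0.le
    nlinarith
  have h9 : Real.log 32 ≤ 5 * Q ^ 2 := by linarith [log_thirtytwo_le_five]
  calc Real.log Hn ≤ Real.log 32 + Real.log T := h2
    _ ≤ 5 * Q ^ 2 + (A * Q ^ 2 + D * Q ^ 2) := by rw [h3]; linarith
    _ = (5 + A + D) * Q ^ 2 := by ring

/-- the exponent of a finite-type measure at the eliminant is `≤ c (c_H + c_N)^k Q^{2k}`. -/
theorem type_exponent_le {c N₁ LH cN cH Q : ℝ} {τ k : ℕ} (hc : 0 ≤ c) (hQ1 : 1 ≤ Q)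
    (hN₁1 : 1 ≤ N₁) (hN₁ : N₁ ≤ cN * Q) (hLH0 : 0 ≤ LH) (hLH : LH ≤ cH * Q ^ 2) (hcN : 0 ≤ cN)
    (_hcH : 0 ≤ cH) (hτk : τ ≤ k) :
    c * (N₁ + LH) ^ τ ≤ c * (cH + cN) ^ k * Q ^ (2 * k) := by
  have hX1 : 1 ≤ N₁ + LH := by linarith
  have hQQ : Q ≤ Q ^ 2 := by nlinarith
  have hcNQ : cN * Q ≤ cN * Q ^ 2 := mul_le_mul_of_nonneg_left hQQ hcN
  have hX : N₁ + LH ≤ (cH + cN) * Q ^ 2 := by nlinarith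
  have h1 : (N₁ + LH) ^ τ ≤ (N₁ + LH) ^ k := pow_le_pow_right₀ hX1 hτk
  have h2 : (N₁ + LH) ^ k ≤ ((cH + cN) * Q ^ 2) ^ k := pow_le_pow_left₀ (by linarith) hX k
  rw [mul_pow, ← pow_mul] at h2
  rw [mul_assoc]
  exact mul_le_mul_of_nonneg_left (h1.trans h2) hc

/-- §23d. The endgame inequality of the FTT engine: the upper bound `exp (A q²) · e^{−q^m}` for `|S(y)|` contradicts a transcendence measure `exp (−c (N + log H)^τ)` of finite type once `m > max τ 2` and `q` is large (pure real-number statement). -/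
theorem endgame_type {Q A₁ A₃ : ℝ} {k m : ℕ} (hQ1 : 1 ≤ Q) (hA₁ : 0 ≤ A₁) (_hA₃ : 0 ≤ A₃)
    (hQA : A₁ + A₃ + 1 ≤ Q) (hk : 1 ≤ k) (hm : m = 2 * k + 1)
    (h : -(A₃ * Q ^ (2 * k)) < A₁ * Q ^ 2 + -(Q ^ m)) : False := by
  subst hm
  have hQ0 : 0 < Q := by linarith
  have h8 : Q ^ 2 ≤ Q ^ (2 * k) := pow_le_pow_right₀ hQ1 (by omega)
  have hQ8 : 0 < Q ^ (2 * k) := by positivity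
  have h9 : A₁ * Q ^ (2 * k) + A₃ * Q ^ (2 * k) + Q ^ (2 * k) ≤ Q ^ (2 * k + 1) := by
    have e : A₁ * Q ^ (2 * k) + A₃ * Q ^ (2 * k) + Q ^ (2 * k) = (A₁ + A₃ + 1) * Q ^ (2 * k) := by
      ring
    rw [e, pow_succ]
    calc (A₁ + A₃ + 1) * Q ^ (2 * k) ≤ Q * Q ^ (2 * k) := mul_le_mul_of_nonneg_right hQA hQ8.le
      _ = Q ^ (2 * k) * Q := by ring
  have h1 : A₁ * Q ^ 2 ≤ A₁ * Q ^ (2 * k) := mul_le_mul_of_nonneg_left h8 hA₁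
  linarith

/-- §23d. Transfer of the hyper-Liouville smallness `η < exp (−Q ^ m)` down to a smaller exponent (real-number bookkeeping). -/
theorem eta_lt_exp_neg_pow_of_le {Q η : ℝ} {m : ℕ} (hQ1 : 1 ≤ Q) (hm : 7 ≤ m)
    (hη : η < Real.exp (-(Q ^ m))) : η < Real.exp (-(Q ^ 7)) := by
  refine hη.trans_le (Real.exp_le_exp.mpr ?_)
  rw [neg_le_neg_iff]
  exact pow_le_pow_right₀ hQ1 hm

end Summit.Schanuel.Schanuel.Theorems.RootDecomp1KRadical
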